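import Literature.NumberTheory.Sieve.SmoothLargeValuesPerPair
import Literature.NumberTheory.Sieve.SmoothLargeValuesDuality
import HarnessLib

/-!
# Large values of exponential sums over smooth numbers, VII: the large-values inequality

Topic `Literature/NumberTheory/Sieve`; a PROVED file toward
`Literature.NumberTheory.DiophantineGeometry.XYZUpperHalf` ([Harper2016, Cor. 1]). The
"small δ" large-values estimate (4.1) of op. cit., in parametric form. Let `θ_r` (`r ∈ T`,
`R = #T`) be points with `|θ_r − θ_s − k| ≥ 1/x` (`r ≠ s`, `k ∈ ℤ`), `|a_n| ≤ 1`, and suppose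
`|∑_{n ≤ x, n ∈ S(y)} a_n e(nθ_r)| ≥ δ𝓟` for all `r`, where `𝓟 = x^α ζ(α,y)/√φ₂(α,y)`. Combining
the duality step (`largeValues_duality`, with `W = x/(yK)`, `A = x/√K`), the uniform bound for
one difference (`sum_geomBound_prefix_le_weight`) and Harmonic Analysis Result 2
(`BourgainSpacing.sum_sum_majorArcWeight_le`) gives

`largeValues_ineq`:
`δ² R² ≤ C (R² (K^{−α/2} + NEG + x^{19/20}/𝓟 + M (1 + log x) Q⋆/x) + M (1 + log x)^{23/2} R^{7/6})`,

with `NEG`, `M = (1+log y)² (Q⋆yK)^{1−α}` as in `sum_geomBound_prefix_le_weight`; and if the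
coefficient of `R²` on the right is at most `δ²/2` then (`largeValues_bound`)
`R ≤ (2 C M (1 + log x)^{23/2} / δ²)^{6/5}` — Harper's `R ≪ δ^{−2−O(1−α)−ε} (log x)^{O(1)}` once
`K`, `Q⋆` are chosen as powers of `δ^{−1} log x` (op. cit., end of §4, p. 18).

## References

* A. J. Harper, *Minor arcs, mean values, and restriction theory for exponential sums over smooth
  numbers*, Compositio Math. 152 (2016) 1121–1158, §4, (4.1) and pp. 15–18 [Harper2016].
-/

noncomputable section

open Finset Real
open scoped FourierTransform
open Literature.NumberTheory.Sieve.Vinogradov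
open Literature.NumberTheory.Sieve.BourgainSpacing

namespace Literature.NumberTheory.Sieve

set_option maxHeartbeats 6000000 in
-- a long assembly
/-- **The large-values inequality** (Harper, proof of (4.1), parametric form). See the module
docstring. [cite: Harper2016, §4, pp. 15–18] -/
theorem largeValues_ineq :
    ∃ C x₀ : ℝ, 0 < C ∧ ∀ (x : ℝ) (y : ℕ), x₀ ≤ x → Real.log x ^ 8 ≤ y →
      Real.log y ≤ 1 / 2 * Real.log x ^ (1 / 6 : ℝ) → (y : ℝ) ^ 200 ≤ x →
      ∀ (K : ℕ), 16 ≤ K → (K : ℝ) ^ 1000 ≤ x → ∀ (Qs : ℝ), 1 ≤ Qs → 2 * Qs ≤ x / (y * K) →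
      Qs ^ 2 * (K : ℝ) ^ 2 * (y : ℝ) ^ 2 ≤ x →
      ∀ {ι : Type*} (T : Finset ι) (θ : ι → ℝ),
        (∀ i ∈ T, ∀ j ∈ T, i ≠ j → ∀ k : ℤ, 1 / x ≤ |θ j - θ i - k|) →
      ∀ (a : ℕ → ℂ), (∀ n, ‖a n‖ ≤ 1) → ∀ (δ : ℝ), 0 < δ →
        (∀ r ∈ T, δ * (x ^ saddlePoint x y *
            (smoothZeta (saddlePoint x y) y / Real.sqrt (saddlePhi₂ (saddlePoint x y) y))) ≤
          ‖∑ n ∈ Nat.smoothNumbersUpTo ⌊x⌋₊ (y + 1), a n * (𝐞 ((n : ℝ) * θ r) : ℂ)‖) →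
        δ ^ 2 * (T.card : ℝ) ^ 2 ≤
          C * ((T.card : ℝ) ^ 2 *
              ((K : ℝ) ^ (-(saddlePoint x y / 2)) +
                (Real.log x ^ 4 * ((y : ℝ) * K) ^ (1 - saddlePoint x y) *
                    (y : ℝ) ^ (5 / 2 * (1 - saddlePoint x y)) *
                    ((K : ℝ) ^ (1 / 2 - saddlePoint x y) +
                      Real.sqrt K * Qs ^ (-(1 / 2 : ℝ) + 3 / 2 * (1 - saddlePoint x y))) +
                  (1 + Real.log y) ^ 2 * (1 + Real.log Qs) * Qs ^ (1 - saddlePoint x y) *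
                    (K : ℝ) ^ (-saddlePoint x y) * (y : ℝ) ^ (1 - saddlePoint x y) +
                  Real.log y * (1 + Real.log Qs + Real.log K + Real.log (Qs ^ 2 * y * (K : ℝ) ^ 2 + 1)) *
                    (y : ℝ) ^ (1 - saddlePoint x y) * (Qs ^ 2 * y * (K : ℝ) ^ 2) ^ (1 - saddlePoint x y) / K) +
                x ^ (19 / 20 : ℝ) / (x ^ saddlePoint x y *
                  (smoothZeta (saddlePoint x y) y / Real.sqrt (saddlePhi₂ (saddlePoint x y) y))) +
                ((1 + Real.log y) ^ 2 * (Qs * y * K) ^ (1 - saddlePoint x y)) * (1 + Real.log x) * Qs / x) +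
            ((1 + Real.log y) ^ 2 * (Qs * y * K) ^ (1 - saddlePoint x y)) *
              (1 + Real.log x) ^ ((23 : ℝ) / 2) * (T.card : ℝ) ^ ((7 : ℝ) / 6)) := by
  classical
  obtain ⟨C_P, x₀P, hC_P, hP⟩ := sum_geomBound_prefix_le_weight
  obtain ⟨C₂, x₀M, hC₂, hM⟩ := card_smoothNumbersUpTo_le_model_of_le
  refine ⟨C₂ * (C₂ + 1200 * C_P + 1), max (max x₀P x₀M) (Real.exp 4), by positivity,
    fun x y hx hy8 hy6 hy200 K hK16 hK1000 Qs hQs hQsW hQsx ι T θ hsep a ha δ hδ hlarge => ?_⟩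
  have hx₀P : x₀P ≤ x := le_trans ((le_max_left _ _).trans (le_max_left _ _)) hx
  have hx₀M : x₀M ≤ x := le_trans ((le_max_right _ _).trans (le_max_left _ _)) hx
  have hxe : Real.exp 4 ≤ x := le_trans (le_max_right _ _) hx
  ------------------------------------------------------------------
  -- ### the range
  set Lx := Real.log x with hLx
  have hLx4 : 4 ≤ Lx := by
    have := Real.log_le_log (Real.exp_pos _) hxe; rwa [Real.log_exp] at this
  have hx32 : 32 ≤ x := by
    have : (32 : ℝ) ≤ Real.exp 4 := by
      have h := Real.exp_one_gt_d9
      have e4 : Real.exp 4 = Real.exp 1 ^ 4 := by rw [← Real.exp_nat_mul]; norm_num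
      rw [e4]
      calc (32 : ℝ) ≤ (2.7182818283 : ℝ) ^ 4 := by norm_num
        _ ≤ Real.exp 1 ^ 4 := pow_le_pow_left₀ (by norm_num) h.le 4
    linarith
  have hx1 : 1 < x := by linarith
  have hx0 : 0 < x := by linarith
  have hLx1 : 1 ≤ Lx := by linarith
  have hLx0 : 0 ≤ Real.log x := by rw [← hLx]; linarith
  have hy4 : Real.log x ^ 4 ≤ y := le_trans (pow_le_pow_right₀ hLx1 (by norm_num)) hy8
  have hy256 : (256 : ℝ) ≤ y := by
    have : (4 : ℝ) ^ 4 ≤ Lx ^ 4 := pow_le_pow_left₀ (by norm_num) hLx4 4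
    norm_num at this; rw [hLx] at this; linarith
  have hy1 : (1 : ℝ) ≤ y := by linarith
  have hy0 : (0 : ℝ) < y := by linarith
  have hy2 : 2 ≤ y := by exact_mod_cast (show (2 : ℝ) ≤ y by linarith)
  have hlogy0 : 0 ≤ Real.log y := Real.log_nonneg hy1
  have hy6' : Real.log y ≤ Real.log x ^ (1 / 6 : ℝ) := by
    refine hy6.trans ?_
    have : 0 ≤ Real.log x ^ (1 / 6 : ℝ) := by positivity
    linarith
  have hK16r : (16 : ℝ) ≤ K := by exact_mod_cast hK16
  have hK0 : (0 : ℝ) < K := by linarith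
  have hQs0 : 0 < Qs := by linarith
  have hlogQs : 0 ≤ Real.log Qs := Real.log_nonneg hQs
  have hlogK : 0 ≤ Real.log K := Real.log_nonneg (by linarith)
  set α := saddlePoint x y with hαdef
  have hα0 : 0 < α := by rw [hαdef]; exact saddlePoint_pos hx1 hy2
  set ζt := smoothZeta α y / Real.sqrt (saddlePhi₂ α y) with hζt
  have hζt0 : 0 < ζt := div_pos (smoothZeta_pos hα0) (Real.sqrt_pos.mpr (saddlePhi₂_pos hy2 hα0))
  set 𝓟 := x ^ α * ζt with h𝓟
  have h𝓟0 : 0 < 𝓟 := by positivity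
  set W := x / (y * K) with hW
  have hyK0 : (0 : ℝ) < y * K := by positivity
  have hW0 : 0 < W := by positivity
  have hW1 : 1 ≤ W := by linarith
  set A := x / Real.sqrt K with hA
  have hsqK4 : 4 ≤ Real.sqrt K := by
    rw [show (4 : ℝ) = Real.sqrt 16 by rw [show (16 : ℝ) = 4 ^ 2 by norm_num, Real.sqrt_sq (by norm_num)]]
    exact Real.sqrt_le_sqrt hK16r
  have hsqK0 : 0 < Real.sqrt K := by linarith
  have hsqKK : Real.sqrt K ≤ K := by
    have := Real.sqrt_le_sqrt (show (K : ℝ) ≤ K ^ 2 by nlinarith)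
    rwa [Real.sqrt_sq hK0.le] at this
  have hWA : W ≤ A := by
    rw [hW, hA]; apply div_le_div_of_nonneg_left hx0.le hsqK0; nlinarith
  have hAx : A ≤ x := by rw [hA]; exact div_le_self hx0.le (by linarith)
  have hA1 : 1 ≤ A := le_trans hW1 hWA
  -- names for the quantities
  set N : ℝ := Real.log x ^ 4 * ((y : ℝ) * K) ^ (1 - α) * (y : ℝ) ^ (5 / 2 * (1 - α)) *
      ((K : ℝ) ^ (1 / 2 - α) + Real.sqrt K * Qs ^ (-(1 / 2 : ℝ) + 3 / 2 * (1 - α))) +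
    (1 + Real.log y) ^ 2 * (1 + Real.log Qs) * Qs ^ (1 - α) * (K : ℝ) ^ (-α) * (y : ℝ) ^ (1 - α) +
    Real.log y * (1 + Real.log Qs + Real.log K + Real.log (Qs ^ 2 * y * (K : ℝ) ^ 2 + 1)) *
      (y : ℝ) ^ (1 - α) * (Qs ^ 2 * y * (K : ℝ) ^ 2) ^ (1 - α) / K with hN
  set M : ℝ := (1 + Real.log y) ^ 2 * (Qs * y * K) ^ (1 - α) with hMdef
  have hB0 : 0 ≤ Qs ^ 2 * y * (K : ℝ) ^ 2 := by positivity
  have hlogB : 0 ≤ Real.log (Qs ^ 2 * y * (K : ℝ) ^ 2 + 1) := Real.log_nonneg (by linarith)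
  have hN0 : 0 ≤ N := by positivity
  have hM0 : 0 ≤ M := by positivity
  obtain ⟨R, hR⟩ : ∃ R : ℝ, R = (T.card : ℝ) := ⟨_, rfl⟩
  have hR0 : 0 ≤ R := by rw [hR]; positivity
  rw [← hR]
  set L : ℝ := 1 + Real.log x with hL
  have hL1 : 1 ≤ L := by rw [hL]; linarith
  show δ ^ 2 * R ^ 2 ≤ C₂ * (C₂ + 1200 * C_P + 1) *
    (R ^ 2 * ((K : ℝ) ^ (-(α / 2)) + N + x ^ (19 / 20 : ℝ) / 𝓟 + M * L * Qs / x) +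
      M * L ^ ((23 : ℝ) / 2) * R ^ ((7 : ℝ) / 6))
  ------------------------------------------------------------------
  -- ### duality
  set S := Nat.smoothNumbersUpTo ⌊x⌋₊ (y + 1) with hS
  have hdual := largeValues_duality T θ (x := x) (W := W) (A := A) (y := y) hW1 hWA hAx a ha
  rw [← hS, ← hR] at hdual
  -- lower bound for the left side
  have hlow : (δ * 𝓟 * R) ^ 2 ≤ (∑ r ∈ T, ‖∑ n ∈ S, a n * (𝐞 ((n : ℝ) * θ r) : ℂ)‖) ^ 2 := by
    have h1 : δ * 𝓟 * R ≤ ∑ r ∈ T, ‖∑ n ∈ S, a n * (𝐞 ((n : ℝ) * θ r) : ℂ)‖ := by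
      calc δ * 𝓟 * R = ∑ r ∈ T, δ * 𝓟 := by rw [Finset.sum_const, nsmul_eq_mul, hR]; ring
        _ ≤ _ := Finset.sum_le_sum fun r hr => hlarge r hr
    exact pow_le_pow_left₀ (by positivity) h1 2
  -- `Ψ(x) ≤ C₂ 𝓟`, `Ψ(A) ≤ C₂ K^{-α/2} 𝓟`
  have hΨx : (S.card : ℝ) ≤ C₂ * 𝓟 := by
    have h1 := hM x y hx₀M hy4 hy6' x hx1.le le_rfl
    rw [← hαdef, ← hS] at h1
    calc (S.card : ℝ) ≤ C₂ * (x ^ α * smoothZeta α y / Real.sqrt (saddlePhi₂ α y)) := h1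
      _ = C₂ * 𝓟 := by rw [h𝓟, hζt]; ring
  have hΨA : ((Nat.smoothNumbersUpTo ⌊A⌋₊ (y + 1)).card : ℝ) ≤ C₂ * ((K : ℝ) ^ (-(α / 2)) * 𝓟) := by
    have h1 := hM x y hx₀M hy4 hy6' A hA1 hAx
    rw [← hαdef] at h1
    have e1 : Real.sqrt (K : ℝ) ^ α = (K : ℝ) ^ (α / 2) := by
      rw [Real.sqrt_eq_rpow, ← Real.rpow_mul hK0.le]
      congr 1; ring
    have hApow : A ^ α = x ^ α * (K : ℝ) ^ (-(α / 2)) := by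
      rw [hA, Real.div_rpow hx0.le hsqK0.le, e1, Real.rpow_neg hK0.le, div_eq_mul_inv]
    calc ((Nat.smoothNumbersUpTo ⌊A⌋₊ (y + 1)).card : ℝ)
        ≤ C₂ * (A ^ α * smoothZeta α y / Real.sqrt (saddlePhi₂ α y)) := h1
      _ = C₂ * ((K : ℝ) ^ (-(α / 2)) * 𝓟) := by rw [hApow, h𝓟, hζt]; ring
  -- the pair sums
  have hpairs : ∑ m ∈ prefixSet y W, ∑ r ∈ T, ∑ s ∈ T, geomBound (x / m) ((m : ℝ) * (θ r - θ s)) ≤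
      R ^ 2 * (C_P * N * 𝓟 + x ^ (19 / 20 : ℝ)) +
        C_P * M * 𝓟 * (1200 * L ^ ((23 : ℝ) / 2) * R ^ ((7 : ℝ) / 6) + 250 * L * Qs * R ^ 2 / x) := by
    rw [Finset.sum_comm]
    have hin : ∀ r ∈ T, ∑ m ∈ prefixSet y W, ∑ s ∈ T, geomBound (x / m) ((m : ℝ) * (θ r - θ s)) ≤
        ∑ s ∈ T, (C_P * N * 𝓟 + x ^ (19 / 20 : ℝ) + C_P * M * 𝓟 * majorArcWeight ⌊Qs⌋₊ x (θ r - θ s)) := by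
      intro r _
      rw [Finset.sum_comm]
      refine Finset.sum_le_sum fun s _ => ?_
      have key := hP x y hx₀P hy8 hy6 hy200 K hK16 hK1000 Qs hQs hQsW hQsx (θ r - θ s)
      rw [← hαdef, ← hW] at key
      refine key.trans (le_of_eq ?_)
      rw [hN, hMdef, h𝓟, hζt]
    have hS7 := sum_sum_majorArcWeight_le hx32 T θ hsep ⌊Qs⌋₊
    have hQfloor : (⌊Qs⌋₊ : ℝ) ≤ Qs := Nat.floor_le hQs0.le
    calc ∑ r ∈ T, ∑ m ∈ prefixSet y W, ∑ s ∈ T, geomBound (x / m) ((m : ℝ) * (θ r - θ s))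
        ≤ ∑ r ∈ T, ∑ s ∈ T, (C_P * N * 𝓟 + x ^ (19 / 20 : ℝ) +
            C_P * M * 𝓟 * majorArcWeight ⌊Qs⌋₊ x (θ r - θ s)) := Finset.sum_le_sum hin
      _ = R ^ 2 * (C_P * N * 𝓟 + x ^ (19 / 20 : ℝ)) +
            C_P * M * 𝓟 * ∑ r ∈ T, ∑ s ∈ T, majorArcWeight ⌊Qs⌋₊ x (θ r - θ s) := by
          simp only [Finset.sum_add_distrib, Finset.sum_const, nsmul_eq_mul, ← Finset.mul_sum]
          rw [hR]; ring
      _ ≤ R ^ 2 * (C_P * N * 𝓟 + x ^ (19 / 20 : ℝ)) +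
            C_P * M * 𝓟 * (1200 * L ^ ((23 : ℝ) / 2) * R ^ ((7 : ℝ) / 6) + 250 * L * ⌊Qs⌋₊ * R ^ 2 / x) := by
          rw [hL, hR]
          have hS7' := mul_le_mul_of_nonneg_left hS7 (show 0 ≤ C_P * M * 𝓟 by positivity)
          exact add_le_add (le_refl _) hS7'
      _ ≤ R ^ 2 * (C_P * N * 𝓟 + x ^ (19 / 20 : ℝ)) +
            C_P * M * 𝓟 * (1200 * L ^ ((23 : ℝ) / 2) * R ^ ((7 : ℝ) / 6) + 250 * L * Qs * R ^ 2 / x) := by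
          gcongr
  ------------------------------------------------------------------
  -- ### combine
  have hmain : (δ * 𝓟 * R) ^ 2 ≤ (C₂ * 𝓟) *
      (R ^ 2 * (C₂ * ((K : ℝ) ^ (-(α / 2)) * 𝓟)) +
        (R ^ 2 * (C_P * N * 𝓟 + x ^ (19 / 20 : ℝ)) +
          C_P * M * 𝓟 * (1200 * L ^ ((23 : ℝ) / 2) * R ^ ((7 : ℝ) / 6) + 250 * L * Qs * R ^ 2 / x))) := by
    refine hlow.trans (hdual.trans ?_)
    have hin0 : 0 ≤ R ^ 2 * ((Nat.smoothNumbersUpTo ⌊A⌋₊ (y + 1)).card : ℝ) +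
        ∑ m ∈ prefixSet y W, ∑ r ∈ T, ∑ s ∈ T, geomBound (x / m) ((m : ℝ) * (θ r - θ s)) := by
      apply add_nonneg (by positivity)
      refine Finset.sum_nonneg fun m _ => Finset.sum_nonneg fun r _ => Finset.sum_nonneg fun s _ => ?_
      exact geomBound_nonneg (by positivity) _
    apply mul_le_mul hΨx _ hin0 (by positivity)
    exact add_le_add (mul_le_mul_of_nonneg_left hΨA (by positivity)) hpairs
  -- divide by `𝓟²`
  have hdiv : δ ^ 2 * R ^ 2 ≤ C₂ * (R ^ 2 * (C₂ * (K : ℝ) ^ (-(α / 2))) +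
      (R ^ 2 * (C_P * N + x ^ (19 / 20 : ℝ) / 𝓟) +
        C_P * M * (1200 * L ^ ((23 : ℝ) / 2) * R ^ ((7 : ℝ) / 6) + 250 * L * Qs * R ^ 2 / x))) := by
    have h1 : (δ * 𝓟 * R) ^ 2 = (δ ^ 2 * R ^ 2) * 𝓟 ^ 2 := by ring
    have h2 : (C₂ * 𝓟) *
        (R ^ 2 * (C₂ * ((K : ℝ) ^ (-(α / 2)) * 𝓟)) +
          (R ^ 2 * (C_P * N * 𝓟 + x ^ (19 / 20 : ℝ)) +
            C_P * M * 𝓟 * (1200 * L ^ ((23 : ℝ) / 2) * R ^ ((7 : ℝ) / 6) + 250 * L * Qs * R ^ 2 / x))) =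
        (C₂ * (R ^ 2 * (C₂ * (K : ℝ) ^ (-(α / 2))) +
          (R ^ 2 * (C_P * N + x ^ (19 / 20 : ℝ) / 𝓟) +
            C_P * M * (1200 * L ^ ((23 : ℝ) / 2) * R ^ ((7 : ℝ) / 6) + 250 * L * Qs * R ^ 2 / x)))) * 𝓟 ^ 2 := by
      field_simp
    rw [h1, h2] at hmain
    exact le_of_mul_le_mul_right hmain (by positivity)
  refine hdiv.trans ?_
  -- bookkeeping of constants
  have hK2 : 0 ≤ (K : ℝ) ^ (-(α / 2)) := by positivity
  have hx19 : 0 ≤ x ^ (19 / 20 : ℝ) / 𝓟 := by positivity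
  have hT1 : 0 ≤ L ^ ((23 : ℝ) / 2) * R ^ ((7 : ℝ) / 6) := by positivity
  have hT2 : 0 ≤ L * Qs * R ^ 2 / x := by positivity
  have hR2 : 0 ≤ R ^ 2 := by positivity
  set C' : ℝ := C₂ * (C₂ + 1200 * C_P + 1) with hC'
  have hc1 : C₂ * C₂ ≤ C' := by rw [hC']; nlinarith
  have hc2 : C₂ * C_P ≤ C' := by rw [hC']; nlinarith
  have hc3 : C₂ ≤ C' := by rw [hC']; nlinarith
  have hc4 : C₂ * C_P * 1200 ≤ C' := by rw [hC']; nlinarith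
  have hc5 : C₂ * C_P * 250 ≤ C' := by rw [hC']; nlinarith
  have e : C₂ * (R ^ 2 * (C₂ * (K : ℝ) ^ (-(α / 2))) +
      (R ^ 2 * (C_P * N + x ^ (19 / 20 : ℝ) / 𝓟) +
        C_P * M * (1200 * L ^ ((23 : ℝ) / 2) * R ^ ((7 : ℝ) / 6) + 250 * L * Qs * R ^ 2 / x))) =
      (C₂ * C₂) * (R ^ 2 * (K : ℝ) ^ (-(α / 2))) + (C₂ * C_P) * (R ^ 2 * N) + C₂ * (R ^ 2 * (x ^ (19 / 20 : ℝ) / 𝓟)) +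
        (C₂ * C_P * 1200) * (M * (L ^ ((23 : ℝ) / 2) * R ^ ((7 : ℝ) / 6))) +
        (C₂ * C_P * 250) * (M * (L * Qs * R ^ 2 / x)) := by ring
  rw [e]
  have f : C' * (R ^ 2 * ((K : ℝ) ^ (-(α / 2)) + N + x ^ (19 / 20 : ℝ) / 𝓟 + M * L * Qs / x) +
      M * L ^ ((23 : ℝ) / 2) * R ^ ((7 : ℝ) / 6)) =
      C' * (R ^ 2 * (K : ℝ) ^ (-(α / 2))) + C' * (R ^ 2 * N) + C' * (R ^ 2 * (x ^ (19 / 20 : ℝ) / 𝓟)) +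
        C' * (M * (L ^ ((23 : ℝ) / 2) * R ^ ((7 : ℝ) / 6))) + C' * (M * (L * Qs * R ^ 2 / x)) := by ring
  rw [f]
  have i1 := mul_le_mul_of_nonneg_right hc1 (mul_nonneg hR2 hK2)
  have i2 := mul_le_mul_of_nonneg_right hc2 (mul_nonneg hR2 hN0)
  have i3 := mul_le_mul_of_nonneg_right hc3 (mul_nonneg hR2 hx19)
  have i4 := mul_le_mul_of_nonneg_right hc4 (mul_nonneg hM0 hT1)
  have i5 := mul_le_mul_of_nonneg_right hc5 (mul_nonneg hM0 hT2)
  linarith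

/-- **The large-values bound** (Harper (4.1), solved for `R`): in the situation of
`largeValues_ineq` with constant `C`, if the coefficient `C · (K^{−α/2} + NEG + x^{19/20}/𝓟 + M L Q⋆/x)`
of `R²` is at most `δ²/2`, then `R ≤ (2 C M (1+log x)^{23/2}/δ²)^{6/5}`.
[cite: Harper2016, §4, (4.1) and p. 18] -/
theorem largeValues_bound_of_ineq {δ R C E M L : ℝ} (hδ : 0 < δ) (hR : 0 ≤ R) (hC : 0 ≤ C)
    (hM : 0 ≤ M) (hL : 0 ≤ L)
    (hineq : δ ^ 2 * R ^ 2 ≤ C * (R ^ 2 * E + M * L ^ ((23 : ℝ) / 2) * R ^ ((7 : ℝ) / 6)))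
    (hsmall : C * E ≤ δ ^ 2 / 2) :
    R ≤ (2 * C * M * L ^ ((23 : ℝ) / 2) / δ ^ 2) ^ ((6 : ℝ) / 5) := by
  rcases eq_or_lt_of_le hR with h0 | hRpos
  · rw [← h0]; positivity
  -- `δ² R²/2 ≤ C M L^{23/2} R^{7/6}`, so `R^{5/6} ≤ 2 C M L^{23/2}/δ²`
  have h1 : δ ^ 2 * R ^ 2 / 2 ≤ C * M * L ^ ((23 : ℝ) / 2) * R ^ ((7 : ℝ) / 6) := by
    have : C * (R ^ 2 * E) ≤ δ ^ 2 / 2 * R ^ 2 := by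
      rw [show C * (R ^ 2 * E) = (C * E) * R ^ 2 by ring]
      exact mul_le_mul_of_nonneg_right hsmall (by positivity)
    nlinarith
  have hR2 : R ^ 2 = R ^ ((7 : ℝ) / 6) * R ^ ((5 : ℝ) / 6) := by
    rw [← Real.rpow_add hRpos, ← Real.rpow_natCast]; norm_num
  have h76 : 0 < R ^ ((7 : ℝ) / 6) := Real.rpow_pos_of_pos hRpos _
  have h2 : R ^ ((5 : ℝ) / 6) ≤ 2 * C * M * L ^ ((23 : ℝ) / 2) / δ ^ 2 := by
    rw [le_div_iff₀ (by positivity)]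
    rw [hR2] at h1
    have h3 : R ^ ((7 : ℝ) / 6) * (R ^ ((5 : ℝ) / 6) * δ ^ 2) ≤ R ^ ((7 : ℝ) / 6) * (2 * C * M * L ^ ((23 : ℝ) / 2)) := by
      nlinarith
    exact le_of_mul_le_mul_left h3 h76
  have h4 : R = (R ^ ((5 : ℝ) / 6)) ^ ((6 : ℝ) / 5) := by
    rw [← Real.rpow_mul hRpos.le]; norm_num
  rw [h4]
  exact Real.rpow_le_rpow (by positivity) h2 (by norm_num)

end Literature.NumberTheory.Sieve

end
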